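import Summits.Ventures.QEC.Census.CertBZPlane
import Summits.Ventures.QEC.Census.GB.S8_60_w5_k4_03B0123.Cert
import HarnessLib

/-!
# `S8_60_w5_k4_03B0123` — lane-engine replays, part 1/1 (census row `S8_60_w5_k4_03B0123`; qec-search-4 orbit lane, emitted by qec-type-08 g7)

`Plane.segOK` verdicts (type-01 lane engine, `decide +kernel`) for segments of the kernel-basis replays of the views of
`Census/GB/S8_60_w5_k4_03B0123/`; assembled in `Distance.lean`.  Generated by `tools/gen4/emit_orbit_row.py`; do not edit by hand.
-/

set_option autoImplicit false
set_option Elab.async false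

namespace Summit.Ventures.QEC.Census.S8_60_w5_k4_03B0123

open Summit.Ventures.QEC.Census

set_option maxHeartbeats 400000000 in
/-- `Z` view 0, lane segment `[0, 46)` (1550200 lanes, depth 5, threshold 10; est 58 s): every selection with largest row there passes (lane engine, KERNEL). -/
theorem psegZ_0_0 : Plane.segOK 120 10 (S8_60_w5_k4_03B0123.cert.sideZ.found.map Prod.fst) S8_60_w5_k4_03B0123.pGZ_0 5 0 46 518 = true := by
  decide +kernel

set_option maxHeartbeats 400000000 in
/-- `Z` view 0, lane segment `[46, 52)` (1342963 lanes, depth 5, threshold 10; est 27 s): every selection with largest row there passes (lane engine, KERNEL). -/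
theorem psegZ_0_1 : Plane.segOK 120 10 (S8_60_w5_k4_03B0123.cert.sideZ.found.map Prod.fst) S8_60_w5_k4_03B0123.pGZ_0 5 46 6 518 = true := by
  decide +kernel

set_option maxHeartbeats 400000000 in
/-- `Z` view 0, lane segment `[52, 56)` (1323259 lanes, depth 5, threshold 10; est 21 s): every selection with largest row there passes (lane engine, KERNEL). -/
theorem psegZ_0_2 : Plane.segOK 120 10 (S8_60_w5_k4_03B0123.cert.sideZ.found.map Prod.fst) S8_60_w5_k4_03B0123.pGZ_0 5 52 4 518 = true := by
  decide +kernel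

set_option maxHeartbeats 400000000 in
/-- `Z` view 0, lane segment `[56, 59)` (1279369 lanes, depth 5, threshold 10; est 13 s): every selection with largest row there passes (lane engine, KERNEL). -/
theorem psegZ_0_3 : Plane.segOK 120 10 (S8_60_w5_k4_03B0123.cert.sideZ.found.map Prod.fst) S8_60_w5_k4_03B0123.pGZ_0 5 56 3 518 = true := by
  decide +kernel

set_option maxHeartbeats 400000000 in
/-- `Z` view 0, lane segment `[59, 62)` (1572829 lanes, depth 5, threshold 10; est 15 s): every selection with largest row there passes (lane engine, KERNEL). -/
theorem psegZ_0_4 : Plane.segOK 120 10 (S8_60_w5_k4_03B0123.cert.sideZ.found.map Prod.fst) S8_60_w5_k4_03B0123.pGZ_0 5 59 3 518 = true := by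
  decide +kernel

end Summit.Ventures.QEC.Census.S8_60_w5_k4_03B0123
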